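import Summits.BirchSwinnertonDyer.BirchSwinnertonDyer.Theorems.AdditiveKolyvaginRoadRamifiedHabitatSignLawEven
import Summits.BirchSwinnertonDyer.BirchSwinnertonDyer.Theorems.AdditiveKolyvaginRoadRamifiedHabitatSignLawInert
import HarnessLib

/-!
# Route `AdditiveKolyvaginRoad`, crux KS′ `LevelKolyvaginSystemsAdditive` (stmt-BirchSwinnertonDyer-21396), card `ramified-toric-habitat` —
# ONE multiplicative prime INERT flips the sign, EVEN habitat discriminant (the Shimura-curve habitat `X^{pq₀}` with `4 ∣ D'`)

Cell `pub/bsd-wall`, width seat `bsd-wall-akr-p2x-w3` g13; `--supports stmt-BirchSwinnertonDyer-21396` (helper). THEOREMS ONLY; no definition,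
no named fact, no `sorry`. BSD is not proved by any of this; KS′/KPA′ stay OPEN at `p² ∣ N`.

w2 g11's part 7 (`…RamifiedHabitatSignLawInert`): in the `p`-ramified habitat `d = p*·d'`, ODD `d'`, making ONE multiplicative prime `q₀ ∣ M`
INERT flips `w(E)·w(E^{(d)})` (card T3 / PART A col. 3: the Shimura curve `X^{pq₀}` is the habitat of the analytic-rank-one rows). Here the same
for an EVEN cofactor `D' = 4m` (`m ≡ 2, 3 (4)` squarefree), on top of this seat's `…SignLawEven` (structural law through the even coprime twist
law, Murty–Murty Ch. 6 §1 via the Kronecker character mod `|D'|`):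

* §1 `jacobiSym_cofactor_eq_neg_legendreSym_of_inert_odd` (`(D'/q₀) = −(q₀/p)` at an inert odd `q₀`),
  `jacobiSym_cofactor_natCast_eq_neg_legendreSym_of_one_inert` (`(D'/M) = −(M/p)`: `M` squarefree odd, exactly one prime inert, the others split);
* §2 `rootNumber_mul_rootNumber_ramifiedTwist_of_four_dvd_of_pStar_of_jacobi` — the structural law with the Jacobi value `(D'/M) = ε·(M/p)` as a
  hypothesis: `w(E)·w(E^{(d)}) = −(−1/p)·ε·(D'/p)^k·r` (`ε = 1`: all split, `…SignLawEven` §2; `ε = −1`: one inert prime);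
* §3 `rootNumber_mul_rootNumber_ramifiedTwist_even_of_one_inert` — `w(E)·w(E^{(d)}) = +(−1/p)·W_p(E)W_p(E^{(p*)})` on the six potentially good
  types `a ∈ {2,3,4,8,9,10}` (`M` squarefree), and the flipped dichotomy `…_eq_neg_one_of_not_dvd` (`e ∤ p − 1 ⟹ −1`), `…_eq_one_of_dvd`
  (`e ∣ p − 1 ⟹ +1`).

Conditional on the Modularity Theorem and Kellock–Dokchitser's Rem. 2.2 at `p` for `E`, `E^{(p*)}`.

References: [cite: MurtyMurty1997, Ch. 6 §1] [cite: Rohrlich1993Compositio, Prop. 2(iv)] [cite: KellockDokchitser2023, Rem. 2.2].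
-/

set_option autoImplicit false
set_option linter.dupNamespace false

noncomputable section

open scoped Classical MatrixGroups NumberTheorySymbols

open CongruenceSubgroup IsDedekindDomain IsDedekindDomain.HeightOneSpectrum NumberField Rat.HeightOneSpectrum
  WeierstrassCurve Literature.NumberTheory.EllipticCurves Literature.NumberTheory.EllipticCurves.ModularForms
  IsDiscreteValuationRing

namespace Summit.BirchSwinnertonDyer.BirchSwinnertonDyer.Theorems.AdditiveKoly.RamifiedHabitat

section EvenInert

variable {p : ℕ} [Fact p.Prime]

/-! ## §1 Jacobi symbols of the even cofactor with one inert prime -/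

/-- At an odd prime `q` INERT in `ℚ(√d)`, `d = p*·D'` (`(d/q) = −1`): `(D'/q) = −(q/p)` (`(p*/q)·(D'/q) = −1`, `(p*/q)² = 1`, `(p*/q) = (q/p)`).
[folklore] -/
theorem jacobiSym_cofactor_eq_neg_legendreSym_of_inert_odd (hp2 : p ≠ 2) {D' : ℤ} {q : ℕ} [Fact q.Prime] (hq2 : q ≠ 2)
    (hinert : J((-1 : ℤ) ^ (p / 2) * p * D' | q) = -1) : J(D' | q) = -legendreSym p q := by
  rw [jacobiSym.mul_left] at hinert
  set A := J((-1 : ℤ) ^ (p / 2) * p | q)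
  haveI : NeZero q := ⟨(Fact.out : q.Prime).ne_zero⟩
  have hA0 : A ≠ 0 := fun h ↦ by rw [h, zero_mul] at hinert; norm_num at hinert
  have hA2 : A * A = 1 := by
    rw [← sq]
    exact jacobiSym.sq_one (by by_contra h; exact hA0 (jacobiSym.eq_zero_iff_not_coprime.mpr h))
  have hAp : A = legendreSym p q := by
    rw [← legendreSym_pStar hp2 hq2, jacobiSym.legendreSym.to_jacobiSym]
  calc J(D' | q) = A * (A * J(D' | q)) := by rw [← mul_assoc, hA2, one_mul]
    _ = -legendreSym p q := by rw [hinert, mul_neg_one, hAp]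

/-- `(D'/M) = −(M/p)` for a squarefree ODD `M` when exactly ONE prime `q₀ ∣ M` is INERT in `ℚ(√d)` (`d = p*·D'`) and every other prime of `M`
splits: `M = q₀·M'`, `(D'/q₀) = −(q₀/p)`, `(D'/M') = (M'/p)` (`…SignLawEven` §1). [folklore] -/
theorem jacobiSym_cofactor_natCast_eq_neg_legendreSym_of_one_inert (hp2 : p ≠ 2) {D' : ℤ} {M : ℕ} (hM : Squarefree M)
    (hM2 : ¬ 2 ∣ M) {q₀ : ℕ} (hq₀ : q₀ ∈ M.primeFactors) (hinert : J((-1 : ℤ) ^ (p / 2) * p * D' | q₀) = -1)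
    (hodd : ∀ q ∈ M.primeFactors, q ≠ q₀ → q ≠ 2 → J((-1 : ℤ) ^ (p / 2) * p * D' | q) = 1) :
    J(D' | M) = -legendreSym p M := by
  have hq₀p : q₀.Prime := Nat.prime_of_mem_primeFactors hq₀
  obtain ⟨M', hM'⟩ := Nat.dvd_of_mem_primeFactors hq₀
  haveI := Fact.mk hq₀p
  have hq₀2 : q₀ ≠ 2 := fun h ↦ hM2 (h ▸ ⟨M', hM'⟩)
  have hM'0 : M' ≠ 0 := fun h ↦ hM.ne_zero (by rw [hM', h, mul_zero])
  have hM'2 : ¬ 2 ∣ M' := fun h ↦ hM2 (hM' ▸ h.mul_left q₀)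
  have hq₀M' : ¬ q₀ ∣ M' := by
    intro h
    have h2 : q₀ * q₀ ∣ M := by rw [hM']; exact mul_dvd_mul_left q₀ h
    exact hq₀p.ne_one (Nat.isUnit_iff.mp (hM q₀ h2))
  have hsplit' : ∀ q ∈ M'.primeFactors, q ≠ 2 → J((-1 : ℤ) ^ (p / 2) * p * D' | q) = 1 := fun q hq hq2 ↦ by
    obtain ⟨hqp, hqM', -⟩ := Nat.mem_primeFactors.mp hq
    refine hodd q (Nat.mem_primeFactors.mpr ⟨hqp, hM' ▸ hqM'.mul_left q₀, hM.ne_zero⟩) ?_ hq2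
    rintro rfl
    exact hq₀M' hqM'
  rw [hM', jacobiSym.mul_right' D' hq₀p.ne_zero hM'0, Nat.cast_mul, legendreSym.mul,
    jacobiSym_cofactor_eq_neg_legendreSym_of_inert_odd hp2 hq₀2 hinert,
    jacobiSym_cofactor_natCast_eq_legendreSym_of_split hp2 hM'0 hM'2 hsplit']
  ring

/-! ## §2 The structural law with the Jacobi value as a hypothesis -/

/-- **`w(E)·w(E^{(d)}) = −(−1/p)·ε·(D'/p)^k·r` from the `p*`-level**, `d = p*·D'` with EVEN cofactor `D' = 4m`, when `(D'/M) = ε·(M/p)`: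
`N_{E'} = M·p^k` (`p ∤ M`), `(D', M p^k) = 1`, `d < 0`, `w(E)·w(E') = (M/p)·r`. (`ε = 1`: every prime of `M` split, `…SignLawEven` §2;
`ε = −1`: exactly one inert prime, §1.) Conditional on `hmod`. [cite: MurtyMurty1997, Ch. 6 §1] -/
theorem rootNumber_mul_rootNumber_ramifiedTwist_of_four_dvd_of_pStar_of_jacobi (W : WeierstrassCurve ℚ) [W.IsElliptic]
    (hmod : exists_isNewformOf) (hp2 : p ≠ 2) {M k : ℕ} (hpM : ¬ p ∣ M)
    (hN' : (W.quadraticTwist (((-1 : ℤ) ^ (p / 2) * p : ℤ) : ℚ)).conductorNorm ℤ = M * p ^ k) {r : ℤ}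
    (hA : W.rootNumber * (W.quadraticTwist (((-1 : ℤ) ^ (p / 2) * p : ℤ) : ℚ)).rootNumber = legendreSym p M * r)
    {D' : ℤ} (h4 : 4 ∣ D') (hm4 : D' / 4 % 4 = 2 ∨ D' / 4 % 4 = 3) (hsq : Squarefree (D' / 4))
    (hgcd : Int.gcd D' (M * p ^ k : ℕ) = 1) (hneg : (-1 : ℤ) ^ (p / 2) * p * D' < 0)
    {ε : ℤ} (hJ : J(D' | M) = ε * legendreSym p M) :
    W.rootNumber * (W.quadraticTwist (((-1 : ℤ) ^ (p / 2) * p * D' : ℤ) : ℚ)).rootNumber =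
      -ZMod.χ₄ p * ε * J(D' | p) ^ k * r := by
  have hp : p.Prime := Fact.out
  have hdZ0 : ((-1 : ℤ) ^ (p / 2) * p : ℤ) ≠ 0 :=
    mul_ne_zero (pow_ne_zero _ (by norm_num)) (by exact_mod_cast hp.ne_zero)
  have hd0 : (((((-1 : ℤ) ^ (p / 2) * p : ℤ)) : ℚ)) ≠ 0 := by exact_mod_cast hdZ0
  haveI hE' : (W.quadraticTwist (((-1 : ℤ) ^ (p / 2) * p : ℤ) : ℚ)).IsElliptic := W.isElliptic_quadraticTwist hd0
  have hgcdN : Int.gcd D' ((W.quadraticTwist (((-1 : ℤ) ^ (p / 2) * p : ℤ) : ℚ)).conductorNorm ℤ) = 1 := by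
    rw [hN']; exact hgcd
  obtain ⟨hB, -⟩ := rootNumber_ramifiedTwist_of_four_dvd W hmod hp2 h4 hm4 hsq hgcdN hneg
  rw [hN'] at hB
  have hM0 : M ≠ 0 := by
    intro h
    have h0 := (W.quadraticTwist (((-1 : ℤ) ^ (p / 2) * p : ℤ) : ℚ)).conductorNorm_pos_holds
    rw [hN', h, zero_mul] at h0
    exact lt_irrefl _ h0
  have hJ' : J(D' | M * p ^ k) = ε * legendreSym p M * J(D' | p) ^ k := by
    rw [jacobiSym.mul_right' D' hM0 (pow_ne_zero k hp.ne_zero), hJ, jacobiSym.pow_right]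
  have hM2' : legendreSym p M * legendreSym p M = 1 := by
    rw [← sq]
    refine legendreSym.sq_one p ?_
    rw [Int.cast_natCast, ne_eq, ZMod.natCast_eq_zero_iff]
    exact hpM
  calc W.rootNumber * (W.quadraticTwist (((-1 : ℤ) ^ (p / 2) * p * D' : ℤ) : ℚ)).rootNumber
      = -ZMod.χ₄ p * J(D' | M * p ^ k) *
          (W.rootNumber * (W.quadraticTwist (((-1 : ℤ) ^ (p / 2) * p : ℤ) : ℚ)).rootNumber) := by
        rw [hB]; push_cast; ring
    _ = -ZMod.χ₄ p * (ε * legendreSym p M * J(D' | p) ^ k) * (legendreSym p M * r) := by rw [hJ', hA]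
    _ = -ZMod.χ₄ p * ε * J(D' | p) ^ k * r := by
        linear_combination (-(ZMod.χ₄ p) * ε * J(D' | p) ^ k * r) * hM2'

/-! ## §3 One inert prime flips the sign, even habitat discriminant -/

omit [Fact p.Prime] in
/-- `M` is odd when `(D', M p²) = 1` and `4 ∣ D'`. [folklore] -/
private theorem not_two_dvd_of_gcd {D' : ℤ} {M : ℕ} (h4 : 4 ∣ D') (hgcd : Int.gcd D' (M * p ^ 2 : ℕ) = 1) : ¬ 2 ∣ M := by
  intro h2M
  have hcop : Nat.Coprime D'.natAbs (M * p ^ 2) := by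
    have h := hgcd
    simp only [Int.gcd, Int.natAbs_natCast] at h
    exact h
  have h2D : 2 ∣ D'.natAbs := by
    have h := Int.natAbs_dvd_natAbs.mpr (dvd_trans (⟨2, by norm_num⟩ : (2 : ℤ) ∣ 4) h4)
    simpa using h
  have h1 : (2 : ℕ) ∣ 1 := by
    rw [← hcop.gcd_eq_one]
    exact Nat.dvd_gcd h2D (h2M.mul_right _)
  omega

/-- **ONE INERT PRIME FLIPS THE SIGN, even habitat discriminant.** `E` semistable away from `p` (`N = M p²`, `M` squarefree), additive potentially
good at `p ≥ 5` of type II/III/IV/IV*/III*/II* (`a = ord_pΔ_min ∈ {2,3,4,8,9,10}`); `d = p*·D'` with `D' = 4m` an even fundamental discriminant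
prime to `N`, `d < 0`, exactly one prime `q₀ ∣ M` INERT in `ℚ(√d)` and every other prime of `M` split. Then
`w(E)·w(E^{(d)}) = +(−1/p)·W_p(E)W_p(E^{(p*)})` — the opposite of the all-split habitat. Conditional on {hmod, F1 at `p`}.
[cite: MurtyMurty1997, Ch. 6 §1] [cite: Rohrlich1993Compositio, Prop. 2(iv)] [cite: KellockDokchitser2023, Rem. 2.2] -/
theorem rootNumber_mul_rootNumber_ramifiedTwist_even_of_one_inert (W : WeierstrassCurve ℚ) [W.IsElliptic]
    (hmod : exists_isNewformOf) (hF1 : W.atkinLehnerEigenvalueAt_eq_localRootNumberAt)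
    (hF1' : (W.quadraticTwist (((-1 : ℤ) ^ (p / 2) * p : ℤ) : ℚ)).atkinLehnerEigenvalueAt_eq_localRootNumberAt)
    (hp5 : 5 ≤ p) {M : ℕ} (hN : W.conductorNorm ℤ = M * p ^ 2) (hM : Squarefree M) (hpM : ¬ p ∣ M) {a : ℕ}
    (hΔ : addVal ℤ_[p] (((W.baseChange ℚ_[p]).minimal ℤ_[p]).integralModel ℤ_[p]).Δ = a)
    (ha : a = 2 ∨ a = 3 ∨ a = 4 ∨ a = 8 ∨ a = 9 ∨ a = 10)
    (hc₄ : addVal ℤ_[p] (((W.baseChange ℚ_[p]).minimal ℤ_[p]).integralModel ℤ_[p]).c₄ ≠ 0)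
    (hj : ¬ 3 * addVal ℤ_[p] (((W.baseChange ℚ_[p]).minimal ℤ_[p]).integralModel ℤ_[p]).c₄ <
      addVal ℤ_[p] (((W.baseChange ℚ_[p]).minimal ℤ_[p]).integralModel ℤ_[p]).Δ)
    {D' : ℤ} (h4 : 4 ∣ D') (hm4 : D' / 4 % 4 = 2 ∨ D' / 4 % 4 = 3) (hsq : Squarefree (D' / 4))
    (hgcd : Int.gcd D' (W.conductorNorm ℤ) = 1) (hneg : (-1 : ℤ) ^ (p / 2) * p * D' < 0)
    {q₀ : ℕ} (hq₀ : q₀ ∈ M.primeFactors) (hinert : J((-1 : ℤ) ^ (p / 2) * p * D' | q₀) = -1)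
    (hodd : ∀ q ∈ M.primeFactors, q ≠ q₀ → q ≠ 2 → J((-1 : ℤ) ^ (p / 2) * p * D' | q) = 1) :
    W.rootNumber * (W.quadraticTwist (((-1 : ℤ) ^ (p / 2) * p * D' : ℤ) : ℚ)).rootNumber =
      ZMod.χ₄ p * (if a % 6 = 3 then 1 else ZMod.χ₄ p * (if p % 3 = 1 then 1 else -1)) := by
  have hp : p.Prime := Fact.out
  have hp2 : p ≠ 2 := by omega
  have hdZ0 : ((-1 : ℤ) ^ (p / 2) * p : ℤ) ≠ 0 :=
    mul_ne_zero (pow_ne_zero _ (by norm_num)) (by exact_mod_cast hp.ne_zero)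
  have hd0 : (((((-1 : ℤ) ^ (p / 2) * p : ℤ)) : ℚ)) ≠ 0 := by exact_mod_cast hdZ0
  haveI hE' : (W.quadraticTwist (((-1 : ℤ) ^ (p / 2) * p : ℤ) : ℚ)).IsElliptic := W.isElliptic_quadraticTwist hd0
  obtain ⟨hadd, hadd', hprod⟩ := localRootNumber_mul_pStarTwist_padic_of_mem W hp5 hΔ ha hc₄ hj
  have hA := rootNumber_mul_rootNumber_pStarTwist_of_localData W hmod hF1 hF1' hp5 hN hM hpM hadd hadd' hprod
  have hN' : (W.quadraticTwist (((-1 : ℤ) ^ (p / 2) * p : ℤ) : ℚ)).conductorNorm ℤ = M * p ^ 2 :=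
    (conductorNorm_pStarTwist_eq W hp5 hadd hadd').trans hN
  have hgcd' : Int.gcd D' (M * p ^ 2 : ℕ) = 1 := by rw [← hN]; exact hgcd
  have hM2 : ¬ 2 ∣ M := not_two_dvd_of_gcd h4 hgcd'
  have hJ : J(D' | M) = (-1) * legendreSym p M := by
    rw [jacobiSym_cofactor_natCast_eq_neg_legendreSym_of_one_inert hp2 hM hM2 hq₀ hinert hodd, neg_one_mul]
  rw [rootNumber_mul_rootNumber_ramifiedTwist_of_four_dvd_of_pStar_of_jacobi W hmod hp2 hpM hN' hA h4 hm4 hsq hgcd' hneg hJ,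
    jacobiSym_cofactor_prime_sq_eq_one hgcd']
  ring

/-- **SHIMURA-CURVE HABITAT, even `D'`: supercuspidal type, one multiplicative prime inert ⟹ sign `−1`** (`e = 12/gcd(12,a) ∤ p − 1`).
Conditional on {hmod, F1 at `p`}; BSD is not proved by this. [cite: Rohrlich1993Compositio, Prop. 2(iv)] [cite: KellockDokchitser2023, Rem. 2.2] -/
theorem rootNumber_mul_rootNumber_ramifiedTwist_even_of_one_inert_eq_neg_one_of_not_dvd (W : WeierstrassCurve ℚ) [W.IsElliptic]
    (hmod : exists_isNewformOf) (hF1 : W.atkinLehnerEigenvalueAt_eq_localRootNumberAt)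
    (hF1' : (W.quadraticTwist (((-1 : ℤ) ^ (p / 2) * p : ℤ) : ℚ)).atkinLehnerEigenvalueAt_eq_localRootNumberAt)
    (hp5 : 5 ≤ p) {M : ℕ} (hN : W.conductorNorm ℤ = M * p ^ 2) (hM : Squarefree M) (hpM : ¬ p ∣ M) {a : ℕ}
    (hΔ : addVal ℤ_[p] (((W.baseChange ℚ_[p]).minimal ℤ_[p]).integralModel ℤ_[p]).Δ = a)
    (ha : a = 2 ∨ a = 3 ∨ a = 4 ∨ a = 8 ∨ a = 9 ∨ a = 10)
    (hc₄ : addVal ℤ_[p] (((W.baseChange ℚ_[p]).minimal ℤ_[p]).integralModel ℤ_[p]).c₄ ≠ 0)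
    (hj : ¬ 3 * addVal ℤ_[p] (((W.baseChange ℚ_[p]).minimal ℤ_[p]).integralModel ℤ_[p]).c₄ <
      addVal ℤ_[p] (((W.baseChange ℚ_[p]).minimal ℤ_[p]).integralModel ℤ_[p]).Δ)
    {D' : ℤ} (h4 : 4 ∣ D') (hm4 : D' / 4 % 4 = 2 ∨ D' / 4 % 4 = 3) (hsq : Squarefree (D' / 4))
    (hgcd : Int.gcd D' (W.conductorNorm ℤ) = 1) (hneg : (-1 : ℤ) ^ (p / 2) * p * D' < 0)
    {q₀ : ℕ} (hq₀ : q₀ ∈ M.primeFactors) (hinert : J((-1 : ℤ) ^ (p / 2) * p * D' | q₀) = -1)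
    (hodd : ∀ q ∈ M.primeFactors, q ≠ q₀ → q ≠ 2 → J((-1 : ℤ) ^ (p / 2) * p * D' | q) = 1)
    (hsc : ¬ 12 / Nat.gcd a 12 ∣ p - 1) :
    W.rootNumber * (W.quadraticTwist (((-1 : ℤ) ^ (p / 2) * p * D' : ℤ) : ℚ)).rootNumber = -1 := by
  have hp2 : p ≠ 2 := by omega
  rw [rootNumber_mul_rootNumber_ramifiedTwist_even_of_one_inert W hmod hF1 hF1' hp5 hN hM hpM hΔ ha hc₄ hj h4 hm4 hsq hgcd hneg hq₀
    hinert hodd]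
  have hp' := (Nat.Prime.eq_two_or_odd (Fact.out : p.Prime)).resolve_left hp2
  have hχ₄ := χ₄_natCast_mul_self hp2
  by_cases h6 : a % 6 = 3
  · have e4 : 12 / Nat.gcd a 12 = 4 := by
      rcases ha with rfl | rfl | rfl | rfl | rfl | rfl <;> simp_all
    rw [e4] at hsc
    have h4' : p % 4 = 3 := by omega
    rw [if_pos h6, mul_one, ZMod.χ₄_nat_three_mod_four h4']
  · have h3 : p % 3 ≠ 1 := by
      intro h3
      rcases ha with rfl | rfl | rfl | rfl | rfl | rfl <;> simp_all <;> omega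
    rw [if_neg h6, if_neg h3, ← mul_assoc, hχ₄]
    norm_num

/-- **… and principal-series type (`e ∣ p − 1`, potentially good), one inert prime, even `D'` ⟹ sign `+1`.** Conditional on {hmod, F1 at `p`}.
[cite: Rohrlich1993Compositio, Prop. 2(iv)] [cite: KellockDokchitser2023, Rem. 2.2] -/
theorem rootNumber_mul_rootNumber_ramifiedTwist_even_of_one_inert_eq_one_of_dvd (W : WeierstrassCurve ℚ) [W.IsElliptic]
    (hmod : exists_isNewformOf) (hF1 : W.atkinLehnerEigenvalueAt_eq_localRootNumberAt)
    (hF1' : (W.quadraticTwist (((-1 : ℤ) ^ (p / 2) * p : ℤ) : ℚ)).atkinLehnerEigenvalueAt_eq_localRootNumberAt)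
    (hp5 : 5 ≤ p) {M : ℕ} (hN : W.conductorNorm ℤ = M * p ^ 2) (hM : Squarefree M) (hpM : ¬ p ∣ M) {a : ℕ}
    (hΔ : addVal ℤ_[p] (((W.baseChange ℚ_[p]).minimal ℤ_[p]).integralModel ℤ_[p]).Δ = a)
    (ha : a = 2 ∨ a = 3 ∨ a = 4 ∨ a = 8 ∨ a = 9 ∨ a = 10)
    (hc₄ : addVal ℤ_[p] (((W.baseChange ℚ_[p]).minimal ℤ_[p]).integralModel ℤ_[p]).c₄ ≠ 0)
    (hj : ¬ 3 * addVal ℤ_[p] (((W.baseChange ℚ_[p]).minimal ℤ_[p]).integralModel ℤ_[p]).c₄ <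
      addVal ℤ_[p] (((W.baseChange ℚ_[p]).minimal ℤ_[p]).integralModel ℤ_[p]).Δ)
    {D' : ℤ} (h4 : 4 ∣ D') (hm4 : D' / 4 % 4 = 2 ∨ D' / 4 % 4 = 3) (hsq : Squarefree (D' / 4))
    (hgcd : Int.gcd D' (W.conductorNorm ℤ) = 1) (hneg : (-1 : ℤ) ^ (p / 2) * p * D' < 0)
    {q₀ : ℕ} (hq₀ : q₀ ∈ M.primeFactors) (hinert : J((-1 : ℤ) ^ (p / 2) * p * D' | q₀) = -1)
    (hodd : ∀ q ∈ M.primeFactors, q ≠ q₀ → q ≠ 2 → J((-1 : ℤ) ^ (p / 2) * p * D' | q) = 1)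
    (hps : 12 / Nat.gcd a 12 ∣ p - 1) :
    W.rootNumber * (W.quadraticTwist (((-1 : ℤ) ^ (p / 2) * p * D' : ℤ) : ℚ)).rootNumber = 1 := by
  have hp2 : p ≠ 2 := by omega
  rw [rootNumber_mul_rootNumber_ramifiedTwist_even_of_one_inert W hmod hF1 hF1' hp5 hN hM hpM hΔ ha hc₄ hj h4 hm4 hsq hgcd hneg hq₀
    hinert hodd]
  have hp' := (Nat.Prime.eq_two_or_odd (Fact.out : p.Prime)).resolve_left hp2
  have hχ₄ := χ₄_natCast_mul_self hp2
  by_cases h6 : a % 6 = 3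
  · have e4 : 12 / Nat.gcd a 12 = 4 := by
      rcases ha with rfl | rfl | rfl | rfl | rfl | rfl <;> simp_all
    rw [e4] at hps
    have h4' : p % 4 = 1 := by omega
    rw [if_pos h6, mul_one, ZMod.χ₄_nat_one_mod_four h4']
  · have h3 : p % 3 = 1 := by
      rcases ha with rfl | rfl | rfl | rfl | rfl | rfl <;> simp_all <;> omega
    rw [if_neg h6, if_pos h3, ← mul_assoc, hχ₄, one_mul]

end EvenInert

end Summit.BirchSwinnertonDyer.BirchSwinnertonDyer.Theorems.AdditiveKoly.RamifiedHabitat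

end
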